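import Summits.Ventures.QEC.Census.CertBZInfoSets
import Summits.Ventures.QEC.Census.HB.HB126a.BZData
import HarnessLib

/-!
# `HB126a` — `bz` certificate, side X: relative-rank BOUNDS per block, tier KERNEL (item S7.BZI; qec-search-7)

For each block `b`: `cert.bzXBound bzData b = true` by `decide +kernel` — the Brouwer–Zimmermann bound
`Σ_i (t_i + 1 − (k_b − relRank_i))`, with the relative ranks RECOUNTED from the information-set masks
(`bzBoundList`), reaches `wEff + 1` (CERT-FORMAT C3 / C17 (6); the `hbound` input of `BZAssembly.forall_lt_of_bz`).
-/

namespace Summit.Ventures.QEC.Census.HB126a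

/-- Block 0: bound 10 ≥ target (kernel). -/
theorem boundX_0 : HB126a.cert.bzXBound HB126a.bzData 0 = true := by decide +kernel

/-- Block 1: bound 10 ≥ target (kernel). -/
theorem boundX_1 : HB126a.cert.bzXBound HB126a.bzData 1 = true := by decide +kernel

/-- Block 2: bound 10 ≥ target (kernel). -/
theorem boundX_2 : HB126a.cert.bzXBound HB126a.bzData 2 = true := by decide +kernel

/-- Block 3: bound 10 ≥ target (kernel). -/
theorem boundX_3 : HB126a.cert.bzXBound HB126a.bzData 3 = true := by decide +kernel

/-- Block 4: bound 10 ≥ target (kernel). -/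
theorem boundX_4 : HB126a.cert.bzXBound HB126a.bzData 4 = true := by decide +kernel

/-- Block 5: bound 10 ≥ target (kernel). -/
theorem boundX_5 : HB126a.cert.bzXBound HB126a.bzData 5 = true := by decide +kernel

/-- Block 6: bound 10 ≥ target (kernel). -/
theorem boundX_6 : HB126a.cert.bzXBound HB126a.bzData 6 = true := by decide +kernel

/-- Block 7: bound 10 ≥ target (kernel). -/
theorem boundX_7 : HB126a.cert.bzXBound HB126a.bzData 7 = true := by decide +kernel

/-- Block 8: bound 10 ≥ target (kernel). -/
theorem boundX_8 : HB126a.cert.bzXBound HB126a.bzData 8 = true := by decide +kernel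

/-- Block 9: bound 10 ≥ target (kernel). -/
theorem boundX_9 : HB126a.cert.bzXBound HB126a.bzData 9 = true := by decide +kernel

/-- Block 10: bound 10 ≥ target (kernel). -/
theorem boundX_10 : HB126a.cert.bzXBound HB126a.bzData 10 = true := by decide +kernel

/-- Block 11: bound 10 ≥ target (kernel). -/
theorem boundX_11 : HB126a.cert.bzXBound HB126a.bzData 11 = true := by decide +kernel

/-- Block 12: bound 10 ≥ target (kernel). -/
theorem boundX_12 : HB126a.cert.bzXBound HB126a.bzData 12 = true := by decide +kernel

/-- Block 13: bound 10 ≥ target (kernel). -/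
theorem boundX_13 : HB126a.cert.bzXBound HB126a.bzData 13 = true := by decide +kernel

/-- Block 14: bound 10 ≥ target (kernel). -/
theorem boundX_14 : HB126a.cert.bzXBound HB126a.bzData 14 = true := by decide +kernel

/-- Block 15: bound 10 ≥ target (kernel). -/
theorem boundX_15 : HB126a.cert.bzXBound HB126a.bzData 15 = true := by decide +kernel

/-- Block 16: bound 10 ≥ target (kernel). -/
theorem boundX_16 : HB126a.cert.bzXBound HB126a.bzData 16 = true := by decide +kernel

end Summit.Ventures.QEC.Census.HB126a
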